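import Mathlib
import HarnessLib

/-!
# Powers of integer linear forms: coefficients, values, common zeros (solo-Schanuel-blind, session 5)

Algebraic core (module K2) of Proposition NG″ of
`run/shared/lean/ideation/Schanuel/solo-blind/paper/nogo.md` §6: at scale `N` the profile no-go witness
is the pair of coprime powers `(q_k X - p_k)^j`, `(q_{k-1} X - p_{k-1})^{j'}` of two consecutive rational
approximants `p_k/q_k` of one real number. This file proves the three elementary facts the serving
argument uses about such powers:

* `abs_coeff_linear_pow_le`: every coefficient of `(qX - p)^j ∈ ℤ[X]` is at most `(|p| + |q|)^j` in
  absolute value (so `log H((q_kX - p_k)^j) ≤ j log(p_k + q_k)`);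
* `aeval_linear_pow`: its value at `x` is `(q x - p)^j`;
* `linear_pow_common_root`: if `(qX - p)^j` and `(q'X - p')^{j'}` (`j, j' ≥ 1`) have a common complex
  zero then `p q' = p' q` — so powers of approximants with distinct values never share a zero.

The placement of Roy's window in the NG″ region is `royAdmissible_profile_nogo₂`
(`SoloBlindProfileNoGoRankTwo.lean`); the analytic bookkeeping (modules K1, K3) is not yet formalised.
-/

namespace Summit.Schanuel.Schanuel.Theorems

open Polynomial

/-- Coefficient recursion for powers of an integer linear form. -/
theorem coeff_linear_pow_succ (p q : ℤ) (j i : ℕ) :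
    ((C q * X - C p) ^ (j + 1)).coeff i =
      (if i = 0 then 0 else ((C q * X - C p) ^ j).coeff (i - 1) * q) -
        ((C q * X - C p) ^ j).coeff i * p := by
  rw [pow_succ, mul_sub, ← mul_assoc, coeff_sub, coeff_mul_C]
  congr 1
  rcases i with _ | i
  · simp [mul_coeff_zero]
  · simp [coeff_mul_X]

/-- One multiplication step: if every coefficient of `f` is at most `B` in absolute value, every
coefficient of `f · (qX - p)` is at most `B (|p| + |q|)`. -/
theorem abs_coeff_mul_linear_le (f : ℤ[X]) (p q B : ℤ) (hB : ∀ i, |f.coeff i| ≤ B) (i : ℕ) :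
    |(f * (C q * X - C p)).coeff i| ≤ B * (|p| + |q|) := by
  have hB0 : 0 ≤ B := (abs_nonneg _).trans (hB 0)
  have hp : 0 ≤ |p| := abs_nonneg p
  have hq : 0 ≤ |q| := abs_nonneg q
  rw [mul_sub, ← mul_assoc, coeff_sub, coeff_mul_C]
  rcases i with _ | i
  · rw [mul_coeff_zero, coeff_X_zero, mul_zero, zero_sub, abs_neg, abs_mul]
    have h0 : |f.coeff 0| * |p| ≤ B * |p| := mul_le_mul_of_nonneg_right (hB 0) hp
    nlinarith
  · rw [coeff_mul_X, coeff_mul_C]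
    have h1 : |f.coeff i| * |q| ≤ B * |q| := mul_le_mul_of_nonneg_right (hB i) hq
    have h2 : |f.coeff (i + 1)| * |p| ≤ B * |p| := mul_le_mul_of_nonneg_right (hB (i + 1)) hp
    have t := abs_sub_le (f.coeff i * q) 0 (f.coeff (i + 1) * p)
    rw [sub_zero, zero_sub, abs_neg, abs_mul, abs_mul] at t
    linarith

/-- **K2 (heights).** Every coefficient of `(qX - p)^j` is bounded by `(|p| + |q|)^j`. -/
theorem abs_coeff_linear_pow_le (p q : ℤ) (j : ℕ) :
    ∀ i, |((C q * X - C p) ^ j).coeff i| ≤ (|p| + |q|) ^ j := by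
  induction j with
  | zero =>
    intro i
    rw [pow_zero, pow_zero, coeff_one]
    split_ifs <;> simp
  | succ j ih =>
    intro i
    rw [pow_succ, pow_succ]
    exact abs_coeff_mul_linear_le _ p q _ ih i

/-- **K2 (values).** The value of `(qX - p)^j` at a point of any commutative ring (canonical `ℤ`-algebra structure). -/
theorem aeval_linear_pow {A : Type*} [CommRing A] (p q : ℤ) (j : ℕ) (x : A) :
    aeval x ((C q * X - C p) ^ j) = ((q : A) * x - (p : A)) ^ j := by
  rw [map_pow, map_sub, map_mul, aeval_C, aeval_X, aeval_C]
  simp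

/-- **K2 (common zeros).** If positive powers of two integer linear forms share a complex zero, the
forms have proportional coefficients: `p q' = p' q`. -/
theorem linear_pow_common_root {p q p' q' : ℤ} {j j' : ℕ} (hj : j ≠ 0) (hj' : j' ≠ 0) {z : ℂ}
    (h₁ : aeval z ((C q * X - C p) ^ j) = 0) (h₂ : aeval z ((C q' * X - C p') ^ j') = 0) :
    p * q' = p' * q := by
  rw [aeval_linear_pow] at h₁ h₂
  have e₁ : (q : ℂ) * z = p := sub_eq_zero.mp (pow_eq_zero_iff hj |>.mp h₁)
  have e₂ : (q' : ℂ) * z = p' := sub_eq_zero.mp (pow_eq_zero_iff hj' |>.mp h₂)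
  have : (p : ℂ) * q' = p' * q := by
    calc (p : ℂ) * q' = (q * z) * q' := by rw [e₁]
      _ = (q' * z) * q := by ring
      _ = p' * q := by rw [e₂]
  exact_mod_cast this

/-- Hence powers of two DISTINCT rational approximants `p/q ≠ p'/q'` (`q, q' ≠ 0`) have no common
complex zero — the zero-freeness of the NG″ family. -/
theorem linear_pow_no_common_root {p q p' q' : ℤ} {j j' : ℕ} (hj : j ≠ 0) (hj' : j' ≠ 0)
    (hne : p * q' ≠ p' * q) (z : ℂ) :
    ¬ (aeval z ((C q * X - C p) ^ j) = 0 ∧ aeval z ((C q' * X - C p') ^ j') = 0) := fun h =>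
  hne (linear_pow_common_root hj hj' h.1 h.2)

/-- Sanity instance: the approximants `5/4` and `21/16` of `x = 1 + 1/4 + 1/16 + 1/256 + …`
(`a = 2, 4, …`): `5·16 ≠ 21·4`. -/
example : (5 : ℤ) * 16 ≠ 21 * 4 := by norm_num

#harness_tags abs_coeff_linear_pow_le

end Summit.Schanuel.Schanuel.Theorems
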